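/-
Copyright (c) 2026 the pub-hodgecm-mathlib formalisation cell (harness21).  Prover seat hodgecm-mathlib-K2E4-p11 (g6), Track B ∕ K2-LIT, h413 = `stmt-HodgeConjecture-24833`,
line `K2_E1_TraceFormulaBeta`, campaign «5Res ENDGAME BY FAMILIES», ROADCARD §3′ D4′c (SD), dealer K2E1-plan (g7) deals (241)∕(243): the VECTOR ∕ PAIRING edition of ★ α p860161
`K2E1MaassSelbergDiagonalRealAxis` — the diagonal Maass–Selberg four-term of a VECTOR-valued section (letters `a = ‖v‖²`, `w(z) = ⟪M(z)v, v⟫`-pairing, `b(z) = ‖M(z)v‖²`), bounded near the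
points of `{ρ₀ < 2·Re}` and `|z − c|²`-bounded at every real pole `c` with `ρ₀ < 2c`.  Mathlib + ★ p860128's ρ₀-free lemmas.
-/
import Summits.HodgeConjecture.HodgeConjecture.Theorems.K2E1MaassSelbergDiagonalRealAxis   -- ★ α p860161 (K2E1-p12 g2): `exists_norm_outer_le` (reused BY NAME); brings ★ p860128 (K2E4-p14 g9): `exists_abs_im_le_mul_abs_im`, `contDiff_cpow_neg_sub_conj`, `norm_conj_sub_self_div`, `exists_abs_im_div_le`
import HarnessLib

/-!
# D4′c (SD) — `K2E1MaassSelbergDiagonalRealAxisVector`: the diagonal four-term IN THE PAIRING CURRENCY `(a, w, b)` — `R_{ρ₀}(z) = Cμ·CK·( T^{z+z̄−ρ₀}∕(z+z̄−ρ₀)·a + T^{z−z̄}∕(z−z̄)·conj(w z)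
# − T^{−(z−z̄)}∕(z−z̄)·w z − T^{−(z+z̄−ρ₀)}∕(z+z̄−ρ₀)·b z )` — bounded near every `z₀` with `ρ₀ < 2·Re z₀` and `|z − c|²`-bounded at every real pole `c` with `ρ₀ < 2c` (generic `ρ₀`; `ρ₀ = 1` prints: all `c > ½`)

Track B ∕ K2-LIT, crux h413 = `stmt-HodgeConjecture-24833`, route of record `HCCMUnconditional`; cell `hodgecm-mathlib`, squad K2, ENGINE E1; dealer K2E1-plan (g7) (243): «census "α scalar ⇒
vector edition with 4th term `‖M(z)v‖²` + `⟪M(x)v,v⟫` real at real x" «=» — that IS the file (`K2E1MaassSelbergDiagonalRealAxisVector`)».  THEOREMS ONLY (no `def`, no `instance`, no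
`notation`, no named-fact hypothesis, no `sorry`); lane `--supports stmt-HodgeConjecture-24833 --as helper` (count-neutral).  Closes no socket.

WHY A NEW EDITION.  ★ α is SCALAR: its section is `φ₀ ∈ ℂ` and its intertwining datum a scalar `c̃(z)`, so its four letters are `κm|φ₀|²`, `κm|φ₀|²·conj c̃`, `κm|φ₀|²·c̃`, `κm|φ₀|²·|c̃|²`.
For the self-dual `χ`-block at M1 the section space `V(χ, K, 1)` has dimension `|ι'|` (★ p860338's basis `bV`) and the datum is an OPERATOR `M(z; χ)`; on the diagonal `(z, v) = (z′, v′)` the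
continued Maass–Selberg relation (★ `diag_eq_fourBracket_of_pairing_on'` ∕ `poleControl_continued_chi_cm_two_of_pairing_on'` currency: `B₁ = a`, `B₂ = conj ∘ w`, `B₃ = w`, `B₄ z z = b z`)
has the THREE INDEPENDENT letters `a` (real: the `⟪v,v⟫`-pairing), `w` (holomorphic: the `⟪M(z)v, v⟫`-pairing) and `b` (real `≥ 0`: the `‖M(z)v‖²`-pairing) — `b ≠ |w|²∕a` unless `v` is
an eigenvector of `M(z)`.  The algebra and the two bounds of α go through VERBATIM with `(κm|φ₀|², c̃) ↦ (a, w, b)`: the middle summands still combine to `(conj k − k)∕(z − z̄)`,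
`k := T^{−(z−z̄)}·w`, bounded by `|Im k|∕|Im z|`, which is bounded near a real point as soon as `w` is REAL ON THE REAL AXIS (`⟪M(x)v, v⟫ ∈ ℝ` for real `x` ⟸ the adjoint letter
`hadj : ⟪x, M(z)y⟫ = ⟪M(z̄)x, y⟫`); the fourth summand needs `b` bounded near `z₀`, resp. `|z − ρ₀|²·b` bounded near the pole (⟸ `(z − ρ₀)·M(z)` bounded, the operator's simple pole).

THE MATHEMATICS [MoeglinWaldspurger1995, IV.2.3, IV.3.12 (a); Arthur1980TraceFormulaII, §4] — as in ★ α, with the substitutions above.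
* §1 **`fourTerm_pairing_diag_eq`** (exact recombination), `norm_fourTerm_pairing_diag_le` (the norm bound off the real axis); ★ α's `exists_norm_outer_le` is reused BY NAME.
* §2 HEADS **`exists_norm_fourTerm_pairing_diag_le`** (near `z₀`, `ρ₀.re < 2·z₀.re`, `w` analytic at `z₀` and real on the real trace if `z₀` is real, `b` bounded near `z₀`) and
  **`exists_normSq_mul_norm_fourTerm_pairing_diag_le`** (the `|z−c|²`-weighted bound at ANY real pole `c` with `ρ₀ < 2c`: `(z−c)·w = d` analytic at `c`, `w` real on the punctured real trace,
  `|z−c|²·b` bounded — ★ α's pole theorem is `c = ρ₀`; for `ρ₀ = 1` every `c ∈ (½, 1]`).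
* §3 `ρ₀ = 1` prints (`U(1,1)`): `exists_normSq_mul_norm_fourTerm_pairing_diag_le_one`, `exists_norm_fourTerm_pairing_diag_le_one`.
CONSUMERS: the χ-twin of FILE β (`|z−c|²·‖Λ^T E(z, v)‖²` bounded near a real pole `c` ⟹ `‖(z−c)·Λ^T E(z,v)‖_{L²}` bounded ⟹ L² residue by ★ γ's Banach brick), then ★ `K2E1ResidueOperatorLettersOfGram`.
HONEST LABEL: HC_CM is proved only modulo the 7 printed citations (2 remaining named inputs: hLiu418 = `stmt-HodgeConjecture-24832`, h413 = `stmt-HodgeConjecture-24833`) until rung 0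
closes; this file asserts no named fact and closes no socket; count-neutral; unconditional.

## References
* [MoeglinWaldspurger1995] C. Mœglin, J.-L. Waldspurger, *Spectral decomposition and Eisenstein series* (1995), IV.2.3, IV.3.12 (a).
* [Arthur1980TraceFormulaII] J. Arthur, *A trace formula for reductive groups II*, Compositio Math. 40 (1980), §4.
-/

set_option autoImplicit false
-- the mandated namespace repeats the single-problem summit's segment (`HodgeConjecture.HodgeConjecture`)
set_option linter.dupNamespace false

noncomputable section

open Set Filter Topology Metric Complex
open scoped ComplexConjugate
open Literature.NumberTheory.EllipticCurves.ModularForms (conj_ofReal_cpow)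
open Summit.HodgeConjecture.HodgeConjecture.Cruxes.H413.K2E1MaassSelbergDiagonalRealAxisCMThree
  (exists_abs_im_le_mul_abs_im contDiff_cpow_neg_sub_conj norm_conj_sub_self_div exists_abs_im_div_le)
open Summit.HodgeConjecture.HodgeConjecture.Cruxes.H413.K2E1MaassSelbergDiagonalRealAxis (exists_norm_outer_le)

namespace Summit.HodgeConjecture.HodgeConjecture.Cruxes.H413.K2E1MaassSelbergDiagonalRealAxisVector

/-! ## §1 The recombined diagonal four-term in the pairing currency `(a, w, b)` -/

/-- **THE EXACT RECOMBINATION OF THE DIAGONAL FOUR-TERM (PAIRING CURRENCY)**: with `k := T^{−(z−z̄)}·w`,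
`R_{ρ₀}(z) = Cμ·CK·( T^{z+z̄−ρ₀}∕(z+z̄−ρ₀)·a + (conj k − k)∕(z − z̄) − T^{−(z+z̄−ρ₀)}∕(z+z̄−ρ₀)·b )`. [cite: MoeglinWaldspurger1995, IV.2.3] -/
theorem fourTerm_pairing_diag_eq (Cμ CK : ℝ) {T : ℝ} (hT : 0 < T) (a b : ℝ) (ρ₀ w z : ℂ) :
    ((Cμ : ℝ) : ℂ) * (((CK : ℝ) : ℂ) *
        ((((T : ℝ) : ℂ) ^ (z + conj z - ρ₀) / (z + conj z - ρ₀)) * ((a : ℝ) : ℂ)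
          + (((T : ℝ) : ℂ) ^ (z - conj z) / (z - conj z)) * conj w
          - (((T : ℝ) : ℂ) ^ (-(z - conj z)) / (z - conj z)) * w
          - (((T : ℝ) : ℂ) ^ (-(z + conj z - ρ₀)) / (z + conj z - ρ₀)) * ((b : ℝ) : ℂ))) =
      ((Cμ : ℝ) : ℂ) * (((CK : ℝ) : ℂ) *
        (((T : ℝ) : ℂ) ^ (z + conj z - ρ₀) / (z + conj z - ρ₀) * ((a : ℝ) : ℂ)
          + (conj (((T : ℝ) : ℂ) ^ (-(z - conj z)) * w) - ((T : ℝ) : ℂ) ^ (-(z - conj z)) * w) / (z - conj z)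
          - ((T : ℝ) : ℂ) ^ (-(z + conj z - ρ₀)) / (z + conj z - ρ₀) * ((b : ℝ) : ℂ))) := by
  have hc1 : conj (((T : ℝ) : ℂ) ^ (-(z - conj z)) * w) = ((T : ℝ) : ℂ) ^ (z - conj z) * conj w := by
    rw [map_mul, conj_ofReal_cpow hT.le, map_neg, map_sub, conj_conj, neg_sub]
  rw [hc1]
  simp only [div_eq_mul_inv]
  ring

/-- **THE NORM OF THE DIAGONAL FOUR-TERM (PAIRING CURRENCY)**, off the real axis:
`‖R_{ρ₀}(z)‖ ≤ ‖Cμ·CK‖·( ‖T^{z+z̄−ρ₀}∕(z+z̄−ρ₀)‖·|a| + |Im k z|∕|Im z| + ‖T^{−(z+z̄−ρ₀)}∕(z+z̄−ρ₀)‖·|b| )`, `k z = T^{−(z−z̄)}·w`. [cite: MoeglinWaldspurger1995, IV.2.3] -/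
theorem norm_fourTerm_pairing_diag_le (Cμ CK : ℝ) {T : ℝ} (hT : 0 < T) (a b : ℝ) (ρ₀ w z : ℂ) :
    ‖((Cμ : ℝ) : ℂ) * (((CK : ℝ) : ℂ) *
        ((((T : ℝ) : ℂ) ^ (z + conj z - ρ₀) / (z + conj z - ρ₀)) * ((a : ℝ) : ℂ)
          + (((T : ℝ) : ℂ) ^ (z - conj z) / (z - conj z)) * conj w
          - (((T : ℝ) : ℂ) ^ (-(z - conj z)) / (z - conj z)) * w
          - (((T : ℝ) : ℂ) ^ (-(z + conj z - ρ₀)) / (z + conj z - ρ₀)) * ((b : ℝ) : ℂ)))‖ ≤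
      ‖((Cμ : ℝ) : ℂ) * ((CK : ℝ) : ℂ)‖ *
        (‖((T : ℝ) : ℂ) ^ (z + conj z - ρ₀) / (z + conj z - ρ₀)‖ * |a| + |(((T : ℝ) : ℂ) ^ (-(z - conj z)) * w).im| / |z.im|
          + ‖((T : ℝ) : ℂ) ^ (-(z + conj z - ρ₀)) / (z + conj z - ρ₀)‖ * |b|) := by
  rw [fourTerm_pairing_diag_eq Cμ CK hT a b ρ₀ w z, ← mul_assoc, norm_mul]
  refine mul_le_mul_of_nonneg_left ?_ (norm_nonneg _)
  refine (norm_sub_le _ _).trans (add_le_add ((norm_add_le _ _).trans (add_le_add ?_ ?_)) ?_)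
  · rw [norm_mul, norm_real, Real.norm_eq_abs]
  · rw [norm_conj_sub_self_div]
  · rw [norm_mul, norm_real, Real.norm_eq_abs]

/-! ## §2 The two bounds -/

/-- **THE DIAGONAL FOUR-TERM (PAIRING CURRENCY) IS BOUNDED NEAR EVERY `z₀` WITH `ρ₀ < 2·Re z₀` AT WHICH `w` IS ANALYTIC AND `b` IS BOUNDED** — off the real axis near `z₀`; if `z₀` is
real, `w` is asked to be real at the real points `x ≠ Re z₀` near it (`⟪M(x)v, v⟫ ∈ ℝ`).  The `1∕|Im z|` of the two middle summands cancels (§1 + ★ p860128 §1). [cite: MoeglinWaldspurger1995, IV.2.3, IV.3.12 (a)]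
[cite: Arthur1980TraceFormulaII, §4] -/
theorem exists_norm_fourTerm_pairing_diag_le (Cμ CK : ℝ) {T : ℝ} (hT : 0 < T) (a : ℝ) {b : ℂ → ℝ} {ρ₀ : ℂ} {w : ℂ → ℂ} {z₀ : ℂ} (hz₀ : ρ₀.re < 2 * z₀.re)
    (hw : AnalyticAt ℂ w z₀) (hreal : z₀.im = 0 → ∀ᶠ x : ℝ in 𝓝[≠] z₀.re, (w (x : ℂ)).im = 0) (hb : ∃ Mb : ℝ, ∀ᶠ z in 𝓝 z₀, |b z| ≤ Mb) :
    ∃ C : ℝ, ∀ᶠ z in 𝓝 z₀, z.im ≠ 0 →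
      ‖((Cμ : ℝ) : ℂ) * (((CK : ℝ) : ℂ) *
        ((((T : ℝ) : ℂ) ^ (z + conj z - ρ₀) / (z + conj z - ρ₀)) * ((a : ℝ) : ℂ)
          + (((T : ℝ) : ℂ) ^ (z - conj z) / (z - conj z)) * conj (w z)
          - (((T : ℝ) : ℂ) ^ (-(z - conj z)) / (z - conj z)) * w z
          - (((T : ℝ) : ℂ) ^ (-(z + conj z - ρ₀)) / (z + conj z - ρ₀)) * ((b z : ℝ) : ℂ)))‖ ≤ C := by
  obtain ⟨B, hB⟩ := exists_norm_outer_le hT hz₀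
  obtain ⟨C₁, hC₁⟩ := exists_abs_im_div_le hT (hw.contDiffAt.restrict_scalars ℝ) hreal
  obtain ⟨Mb, hMb⟩ := hb
  set K₀ : ℝ := ‖((Cμ : ℝ) : ℂ) * ((CK : ℝ) : ℂ)‖ with hK₀
  refine ⟨K₀ * (B * |a| + C₁ + B * Mb), ?_⟩
  filter_upwards [hB, hC₁, hMb] with z hzB hzC hzM hzim
  refine (norm_fourTerm_pairing_diag_le Cμ CK hT a (b z) ρ₀ (w z) z).trans (mul_le_mul_of_nonneg_left ?_ (norm_nonneg _))
  have hB0 : 0 ≤ B := (norm_nonneg _).trans hzB.1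
  exact add_le_add (add_le_add (mul_le_mul_of_nonneg_right hzB.1 (abs_nonneg _)) (hzC hzim)) (mul_le_mul hzB.2 hzM (abs_nonneg _) hB0)

/-- **THE `|z − c|²`-WEIGHTED DIAGONAL FOUR-TERM (PAIRING CURRENCY) IS BOUNDED NEAR A REAL POLE `c` WITH `ρ₀ < 2c`** (off the real axis) — e.g. every `c ∈ (½, 1]` for `ρ₀ = 1` —
where the holomorphic pairing `w` has a simple pole: `(z − c)·w = d` near `c` with `d` analytic at `c`, `w` real at the real points `x ≠ c` near `c`, and `|z − c|²·b` bounded near `c`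
(the operator's simple pole: `‖(z−c)M(z)v‖²` bounded).  With `k₂ := conj(z−c)·T^{−(z−z̄)}·d`: `|z−c|²·|Im k| = |Im k₂| ≤ C|Im z|` (★ p860128 §1); the outer coefficients are regular at `c`
(`2c − ρ₀ ≠ 0`).  ★ α's pole theorem is the case `c = ρ₀`. [cite: MoeglinWaldspurger1995, IV.2.3, IV.3.12 (a)] [cite: Arthur1980TraceFormulaII, §4] -/
theorem exists_normSq_mul_norm_fourTerm_pairing_diag_le (Cμ CK : ℝ) {T : ℝ} (hT : 0 < T) (a : ℝ) {b : ℂ → ℝ} {ρ₀ : ℂ} {c : ℝ} (hc : ρ₀.re < 2 * c) {w d : ℂ → ℂ}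
    (hd : AnalyticAt ℂ d c) (hdw : ∀ᶠ z : ℂ in 𝓝[≠] (c : ℂ), d z = (z - c) * w z) (hreal : ∀ᶠ x : ℝ in 𝓝[≠] c, (w (x : ℂ)).im = 0)
    (hb : ∃ Mb : ℝ, ∀ᶠ z : ℂ in 𝓝[≠] (c : ℂ), ‖z - (c : ℂ)‖ ^ 2 * |b z| ≤ Mb) :
    ∃ C : ℝ, ∀ᶠ z : ℂ in 𝓝[≠] (c : ℂ), z.im ≠ 0 →
      ‖z - (c : ℂ)‖ ^ 2 * ‖((Cμ : ℝ) : ℂ) * (((CK : ℝ) : ℂ) *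
        ((((T : ℝ) : ℂ) ^ (z + conj z - ρ₀) / (z + conj z - ρ₀)) * ((a : ℝ) : ℂ)
          + (((T : ℝ) : ℂ) ^ (z - conj z) / (z - conj z)) * conj (w z)
          - (((T : ℝ) : ℂ) ^ (-(z - conj z)) / (z - conj z)) * w z
          - (((T : ℝ) : ℂ) ^ (-(z + conj z - ρ₀)) / (z + conj z - ρ₀)) * ((b z : ℝ) : ℂ)))‖ ≤ C := by
  -- the outer coefficients near `c`
  obtain ⟨B, hB⟩ := exists_norm_outer_le hT (ρ₀ := ρ₀) (z₀ := (c : ℂ)) (by rw [ofReal_re]; exact hc)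
  obtain ⟨Mb, hMb⟩ := hb
  -- `k₂ := conj(z−c)·T^{−(z−z̄)}·d` is `C¹` at `c` and real on the punctured real trace
  have hk₂ : ContDiffAt ℝ 1 (fun z : ℂ => conj (z - c) * (((T : ℝ) : ℂ) ^ (-(z - conj z)) * d z)) (c : ℂ) := by
    have hconj : ContDiff ℝ 1 (fun z : ℂ => conj z) := by
      have : (fun z : ℂ => conj z) = ⇑conjCLE := funext fun z => (conjCLE_apply z).symm
      rw [this]; exact conjCLE.contDiff
    exact (hconj.comp (contDiff_id.sub contDiff_const)).contDiffAt.mul (((contDiff_cpow_neg_sub_conj hT).contDiffAt).mul (hd.contDiffAt.restrict_scalars ℝ))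
  have hdw' : ∀ᶠ x : ℝ in 𝓝[≠] c, d (x : ℂ) = ((x : ℂ) - c) * w (x : ℂ) := by
    have ht : Tendsto (fun x : ℝ => (x : ℂ)) (𝓝[≠] c) (𝓝[≠] (c : ℂ)) := by
      refine tendsto_nhdsWithin_of_tendsto_nhds_of_eventually_within _ ((continuous_ofReal.tendsto c).mono_left nhdsWithin_le_nhds) ?_
      filter_upwards [self_mem_nhdsWithin] with x hx
      simp only [mem_compl_iff, mem_singleton_iff] at hx ⊢
      exact fun h => hx (ofReal_injective h)
    exact ht.eventually hdw
  have hk₂real : ∀ᶠ x : ℝ in 𝓝[≠] c, ((fun z : ℂ => conj (z - c) * (((T : ℝ) : ℂ) ^ (-(z - conj z)) * d z)) (x : ℂ)).im = 0 := by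
    filter_upwards [hreal, hdw'] with x hx hxd
    simp only [hxd, conj_ofReal, sub_self, neg_zero, cpow_zero, one_mul, map_sub, mul_im, sub_re, sub_im, ofReal_re, ofReal_im, hx]
    ring
  obtain ⟨C₁, hC₁⟩ := exists_abs_im_le_mul_abs_im hk₂ hk₂real
  set K₀ : ℝ := ‖((Cμ : ℝ) : ℂ) * ((CK : ℝ) : ℂ)‖ with hK₀
  refine ⟨K₀ * (B * |a| + C₁ + B * Mb), ?_⟩
  have hball : ∀ᶠ z : ℂ in 𝓝[≠] (c : ℂ), ‖z - (c : ℂ)‖ ≤ 1 := by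
    filter_upwards [mem_nhdsWithin_of_mem_nhds (Metric.closedBall_mem_nhds (c : ℂ) one_pos)] with z hz
    rwa [Metric.mem_closedBall, dist_eq_norm] at hz
  filter_upwards [mem_nhdsWithin_of_mem_nhds hB, mem_nhdsWithin_of_mem_nhds hC₁, hMb, hdw, hball] with z hzB hzC hzM hzd hz1 hzim
  have hB0 : 0 ≤ B := (norm_nonneg _).trans hzB.1
  have hsq : ‖z - (c : ℂ)‖ ^ 2 ≤ 1 := by nlinarith [norm_nonneg (z - (c : ℂ))]
  -- `|z−c|²·|Im k| = |Im k₂|`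
  have hk₂eq : (((‖z - (c : ℂ)‖ ^ 2 : ℝ)) : ℂ) * (((T : ℝ) : ℂ) ^ (-(z - conj z)) * w z) = conj (z - c) * (((T : ℝ) : ℂ) ^ (-(z - conj z)) * d z) := by
    rw [hzd, ofReal_pow, ← conj_mul' (z - c)]; ring
  have hmid : ‖z - (c : ℂ)‖ ^ 2 * (|(((T : ℝ) : ℂ) ^ (-(z - conj z)) * w z).im| / |z.im|) ≤ C₁ := by
    rw [← mul_div_assoc, div_le_iff₀ (abs_pos.2 hzim), ← abs_of_nonneg (sq_nonneg ‖z - (c : ℂ)‖), ← abs_mul, ← im_ofReal_mul, hk₂eq]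
    exact hzC
  calc ‖z - (c : ℂ)‖ ^ 2 * _ ≤ ‖z - (c : ℂ)‖ ^ 2 * (K₀ * (‖((T : ℝ) : ℂ) ^ (z + conj z - ρ₀) / (z + conj z - ρ₀)‖ * |a| + |(((T : ℝ) : ℂ) ^ (-(z - conj z)) * w z).im| / |z.im|
          + ‖((T : ℝ) : ℂ) ^ (-(z + conj z - ρ₀)) / (z + conj z - ρ₀)‖ * |b z|)) :=
        mul_le_mul_of_nonneg_left (norm_fourTerm_pairing_diag_le Cμ CK hT a (b z) ρ₀ (w z) z) (sq_nonneg _)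
    _ = K₀ * (‖z - (c : ℂ)‖ ^ 2 * (‖((T : ℝ) : ℂ) ^ (z + conj z - ρ₀) / (z + conj z - ρ₀)‖ * |a|) + ‖z - (c : ℂ)‖ ^ 2 * (|(((T : ℝ) : ℂ) ^ (-(z - conj z)) * w z).im| / |z.im|)
          + ‖((T : ℝ) : ℂ) ^ (-(z + conj z - ρ₀)) / (z + conj z - ρ₀)‖ * (‖z - (c : ℂ)‖ ^ 2 * |b z|)) := by ring
    _ ≤ K₀ * (B * |a| + C₁ + B * Mb) := by
        refine mul_le_mul_of_nonneg_left (add_le_add (add_le_add ?_ hmid) ?_) (norm_nonneg _)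
        · calc ‖z - (c : ℂ)‖ ^ 2 * (‖((T : ℝ) : ℂ) ^ (z + conj z - ρ₀) / (z + conj z - ρ₀)‖ * |a|) ≤ 1 * (B * |a|) :=
                mul_le_mul hsq (mul_le_mul_of_nonneg_right hzB.1 (abs_nonneg _)) (by positivity) zero_le_one
            _ = B * |a| := one_mul _
        · exact mul_le_mul hzB.2 hzM (by positivity) hB0

/-! ## §3 The instance of record `ρ₀ = 1` (`U(1,1)`), by specialisation -/

/-- **(MS-c)'s vector heart for `U(1,1)`**: the `ρ₀ = 1` instance of `exists_normSq_mul_norm_fourTerm_pairing_diag_le` at ANY real pole `c > ½` (shift `z + z̄ − 1`), in the `N = 2`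
pairing currency of ★ `poleControl_continued_chi_cm_two_of_pairing_on'` (`B₁ = a`, `B₂ = conj ∘ w`, `B₃ = w`, `B₄ z z = b z`). [cite: MoeglinWaldspurger1995, IV.2.3, IV.3.12 (a)] -/
theorem exists_normSq_mul_norm_fourTerm_pairing_diag_le_one (Cμ CK : ℝ) {T : ℝ} (hT : 0 < T) (a : ℝ) {b : ℂ → ℝ} {c : ℝ} (hc : 1 / 2 < c) {w d : ℂ → ℂ}
    (hd : AnalyticAt ℂ d c) (hdw : ∀ᶠ z : ℂ in 𝓝[≠] (c : ℂ), d z = (z - c) * w z) (hreal : ∀ᶠ x : ℝ in 𝓝[≠] c, (w (x : ℂ)).im = 0)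
    (hb : ∃ Mb : ℝ, ∀ᶠ z : ℂ in 𝓝[≠] (c : ℂ), ‖z - (c : ℂ)‖ ^ 2 * |b z| ≤ Mb) :
    ∃ C : ℝ, ∀ᶠ z : ℂ in 𝓝[≠] (c : ℂ), z.im ≠ 0 →
      ‖z - (c : ℂ)‖ ^ 2 * ‖((Cμ : ℝ) : ℂ) * (((CK : ℝ) : ℂ) *
        ((((T : ℝ) : ℂ) ^ (z + conj z - 1) / (z + conj z - 1)) * ((a : ℝ) : ℂ)
          + (((T : ℝ) : ℂ) ^ (z - conj z) / (z - conj z)) * conj (w z)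
          - (((T : ℝ) : ℂ) ^ (-(z - conj z)) / (z - conj z)) * w z
          - (((T : ℝ) : ℂ) ^ (-(z + conj z - 1)) / (z + conj z - 1)) * ((b z : ℝ) : ℂ)))‖ ≤ C :=
  exists_normSq_mul_norm_fourTerm_pairing_diag_le Cμ CK hT a (ρ₀ := 1) (by rw [one_re]; linarith) hd hdw hreal hb

/-- **(MS-P) at real points for `U(1,1)`, pairing currency**: the `ρ₀ = 1` instance of `exists_norm_fourTerm_pairing_diag_le` (`½ < Re z₀`). [cite: MoeglinWaldspurger1995, IV.2.3, IV.3.12 (a)] -/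
theorem exists_norm_fourTerm_pairing_diag_le_one (Cμ CK : ℝ) {T : ℝ} (hT : 0 < T) (a : ℝ) {b : ℂ → ℝ} {w : ℂ → ℂ} {z₀ : ℂ} (hz₀ : 1 / 2 < z₀.re)
    (hw : AnalyticAt ℂ w z₀) (hreal : z₀.im = 0 → ∀ᶠ x : ℝ in 𝓝[≠] z₀.re, (w (x : ℂ)).im = 0) (hb : ∃ Mb : ℝ, ∀ᶠ z in 𝓝 z₀, |b z| ≤ Mb) :
    ∃ C : ℝ, ∀ᶠ z in 𝓝 z₀, z.im ≠ 0 →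
      ‖((Cμ : ℝ) : ℂ) * (((CK : ℝ) : ℂ) *
        ((((T : ℝ) : ℂ) ^ (z + conj z - 1) / (z + conj z - 1)) * ((a : ℝ) : ℂ)
          + (((T : ℝ) : ℂ) ^ (z - conj z) / (z - conj z)) * conj (w z)
          - (((T : ℝ) : ℂ) ^ (-(z - conj z)) / (z - conj z)) * w z
          - (((T : ℝ) : ℂ) ^ (-(z + conj z - 1)) / (z + conj z - 1)) * ((b z : ℝ) : ℂ)))‖ ≤ C :=
  exists_norm_fourTerm_pairing_diag_le Cμ CK hT a (ρ₀ := 1) (by rw [one_re]; linarith) hw hreal hb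

end Summit.HodgeConjecture.HodgeConjecture.Cruxes.H413.K2E1MaassSelbergDiagonalRealAxisVector

end
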